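import Summits.Langlands.Langlands.Theorems.PicardMuOrdinaryMuOrdinaryFamilyRTDefs
import Literature.NumberTheory.GaloisRepresentations.IntegralGaloisActionProofs
import Summits.Langlands.Langlands.Theorems.PicardMuOrdinaryIrregularClassicalityPlaceOfMaximalIdeal

/-!
# Route `PicardMuOrdinary`, crux `MuOrdinaryFamilyRT` (stmt-Langlands-13757),
# line `free-seed-smooth-rt`: the endgame stub `stub_endgame`

Stub `stub_endgame` (STUB 5, the card's K3) of the registered skeleton
`Cruxes/MuOrdinaryFamilyRT/Lines/free-seed-smooth-rt.lean` for the crux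
`Summit.Langlands.Langlands.Theses.PicardMuOrdinary.MuOrdinaryFamilyRT` (stmt-Langlands-13757):
`theorem stub_endgame : S.stub_endgame`, declared in the skeleton's namespace
`Summit.Langlands.Langlands.Cruxes.MuOrdinaryFamilyRT.FreeSeedSmoothRt` (vocabulary `K`, `Generic`,
`LimitConclusion`, `badPrimes`, `picardC`, `PointData`, `HostData`, `S.stub_endgame` from
`Theorems/PicardMuOrdinaryMuOrdinaryFamilyRTDefs.lean`).

**Statement.**  Given the host `h : HostData hcpt d` of a Picard point datum `d : PointData f ι e`,
the Picard point transported to `h.T` (`x' ∘ φ = j ∘ x`) and, for every `M`, a point `y` of `h.T`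
over an arithmetic weight with `‖y t - x' t‖ ≤ 3⁻ᴹ` for all `t`, the crux's conclusion
`LimitConclusion f hcpt` holds.

**Proof.**  Witnesses: `e := e`; `S := S(f) = badPrimes f`, finite because
`3 · disc f · lc f ≠ 0` for a separable quartic (`resultant_deriv`, `resultant_ne_zero` over `ℚ`)
and a nonzero element of `𝓞 K` has finitely many prime factors (`Ideal.finite_factors`);
`𝔐 := {z ∈ ℤ̄ : ‖ι⁻¹ z‖ < 1}`, a prime ideal (algebraic integers have `3`-adic norm `≤ 1`,
`padicAlgCl_norm_le_one_of_isIntegral`) containing `3` (`‖3‖ = 3⁻¹`), and MAXIMAL because `ℤ̄ / ℤ`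
is integral and `𝔐 ∩ ℤ ∋ 3` is a nonzero prime of the PID `ℤ`
(`Ideal.isMaximal_of_isIntegral_of_isMaximal_comap`).  For each `k` take `y` with `M := k`;
`h.classical` makes it classical: a regular algebraic cuspidal `P` with, off `S(f)`, Satake
parameters `α` and `b := N𝔭 · Σα ∈ ℤ̄` equal to `ι(y(φ tr ρ(σ))) · N𝔭^{2·3ᵏc}` at any arithmetic
Frobenius `σ` (one exists: `primesAbove_nonempty`, `exists_isArithFrobAt_of_mem_primesAbove_holds`),
while `d.x_trace` and `x' ∘ φ = j ∘ x` give `x'(φ tr ρ(σ)) = ι⁻¹ e(a_𝔭)`.  With `t := b - e(a_𝔭) ∈ ℤ̄`: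
`ι⁻¹ t = (y - x')(φ tr) · N^{2·3ᵏc} + x'(φ tr) · (N^{2·3ᵏc} - 1)` has norm `≤ 3⁻ᵏ` by the ultrametric
inequality, since `‖(y - x')(·)‖ ≤ 3⁻ᵏ`, `‖N‖ ≤ 1`, `‖x'(φ r)‖ = ‖j(x r)‖ ≤ 1` (`𝒪` is finite over
`ℤ₃`, so `j(x r)` is integral over `ℤ₃`, and the closed unit ball of `ℚ̄₃` is integrally closed and
contains `ℤ₃`) and `3ᵏ⁺¹ ∣ N^{2·3ᵏc} - 1` for `3 ∤ N = N𝔭` (`3 ∉ 𝔭` off `S(f)`; the residue field has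
characteristic `≠ 3`; `N² ≡ 1 (3)` and `dvd_sub_pow_of_dvd_sub`).  Finally the DICTIONARY
`exists_not_mem_and_mul_mem_span_pow`: `‖ι⁻¹ t‖ ≤ 3⁻ᵏ ⟹ ∃ u ∉ 𝔐, u t ∈ 3ᵏ ℤ̄`, proved inside the
number field `L = ℚ(t)`: for the proper ideal `J = 𝔐 ∩ 𝓞 L` of the Dedekind domain `𝓞 L`, Mathlib's
`Ideal.exist_integer_multiples_notMem` applied to `(1, t / 3ᵏ)` yields `w₀ ∈ 𝓞 L` with
`w₁ := w₀ t / 3ᵏ ∈ 𝓞 L` and (`w₀ ∉ J` or `w₁ ∉ J`); if `w₀ ∈ J` then `w₁ ∉ J` is absurd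
(`3⁻ᵏ ≤ ‖w₁‖ 3⁻ᵏ = ‖w₀‖ ‖t‖ < 3⁻ᵏ`), so `u := w₀` works.  (The converse direction of this dictionary
is `Theorems/PicardMuOrdinaryIrregularClassicalityPlaceOfMaximalIdeal.lean`, whose `3`-adic
bookkeeping lemmas are reused.)

Only Mathlib and proved tree declarations are used; no new definitions, no named facts.
-/

-- `Summit.Langlands.Langlands.…` (summit = sub-problem name, D-0017 layout) trips `dupNamespace` on every decl.
set_option linter.dupNamespace false
set_option autoImplicit false

namespace Summit.Langlands.Langlands.Cruxes.MuOrdinaryFamilyRT.FreeSeedSmoothRt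

open scoped NumberField Polynomial
open IsDedekindDomain Polynomial
open Literature.NumberTheory.GaloisRepresentations Literature.NumberTheory.Automorphic
open Summit.Langlands.Langlands.Theorems.IrregularClassicality.SplitRamifiedPrimeSqrt6

noncomputable section

/-! ### A. `3`-adic bookkeeping in `ℚ̄₃ = PadicAlgCl 3` -/

/-- Integers have norm `≤ 1` in `ℚ̄₃`. -/
theorem norm_intCast_le_one (m : ℤ) : ‖(m : PadicAlgCl 3)‖ ≤ 1 :=
  padicAlgCl_norm_le_one_of_isIntegral
    (by simpa only [eq_intCast] using isIntegral_algebraMap (R := ℤ) (A := PadicAlgCl 3) (x := m))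

/-- Natural numbers have norm `≤ 1` in `ℚ̄₃`. -/
theorem norm_natCast_le_one (n : ℕ) : ‖(n : PadicAlgCl 3)‖ ≤ 1 := by
  exact_mod_cast norm_intCast_le_one (n : ℤ)

/-- Elements of `ℤ̄ ⊂ ℂ` have norm `≤ 1` under any `ι⁻¹ : ℂ ≃ ℚ̄₃`. -/
theorem norm_symm_coe_le_one (ι : PadicAlgCl 3 ≃+* ℂ) (z : integralClosure ℤ ℂ) :
    ‖ι.symm (z : ℂ)‖ ≤ 1 :=
  padicAlgCl_norm_le_one_of_isIntegral (map_isIntegral_int ι.symm.toRingHom z.2)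

/-- Elements of `ℚ̄₃` integral over `ℤ₃` have norm `≤ 1` (the closed unit ball is the valuation
ring, which contains `ℤ₃` and is integrally closed). -/
theorem norm_le_one_of_isIntegral_padicInt {y : PadicAlgCl 3} (hy : IsIntegral ℤ_[3] y) :
    ‖y‖ ≤ 1 := by
  have hv := Valuation.integer.integers (Valued.v (R := PadicAlgCl 3) (Γ₀ := NNReal))
  have hZ : ∀ a : ℤ_[3], algebraMap ℤ_[3] (PadicAlgCl 3) a ∈
      (Valued.v (R := PadicAlgCl 3) (Γ₀ := NNReal)).integer := fun a => by
    change Valued.v (algebraMap ℤ_[3] (PadicAlgCl 3) a) ≤ 1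
    rw [PadicAlgCl.valuation_def, ← NNReal.coe_le_coe, coe_nnnorm, NNReal.coe_one,
      IsScalarTower.algebraMap_apply ℤ_[3] ℚ_[3] (PadicAlgCl 3), PadicAlgCl.norm_extends]
    exact PadicInt.norm_le_one a
  let φ : ℤ_[3] →+* (Valued.v (R := PadicAlgCl 3) (Γ₀ := NNReal)).integer :=
    (algebraMap ℤ_[3] (PadicAlgCl 3)).codRestrict _ hZ
  obtain ⟨P, hPm, hP⟩ := hy
  have hy' : IsIntegral (Valued.v (R := PadicAlgCl 3) (Γ₀ := NNReal)).integer y := by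
    refine ⟨P.map φ, hPm.map φ, ?_⟩
    rw [eval₂_map]
    exact hP
  have h1 := hv.isIntegral_iff_v_le_one.mp hy'
  rw [PadicAlgCl.valuation_def] at h1
  exact_mod_cast h1

/-- `3 ^ (k + 1) ∣ N ^ (2·3^k·c) - 1` for `3 ∤ N`. -/
theorem pow_succ_dvd_pow_sub_one {N : ℤ} (hN : ¬ (3 : ℤ) ∣ N) (k c : ℕ) :
    (3 : ℤ) ^ (k + 1) ∣ N ^ (2 * 3 ^ k * c) - 1 := by
  have key : ∀ x : ZMod 3, x ≠ 0 → x ^ 2 - 1 = 0 := by decide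
  have h1 : (3 : ℤ) ∣ N ^ 2 - 1 := by
    have hx := key (N : ZMod 3) (by rwa [Ne, ZMod.intCast_zmod_eq_zero_iff_dvd])
    have h := (ZMod.intCast_zmod_eq_zero_iff_dvd (N ^ 2 - 1) 3).1 (by push_cast; exact hx)
    exact_mod_cast h
  have h2 : (3 : ℤ) ∣ N ^ (2 * c) - 1 := by
    have := sub_dvd_pow_sub_pow (N ^ 2) 1 c
    rw [one_pow, ← pow_mul] at this
    exact h1.trans this
  have h3 := dvd_sub_pow_of_dvd_sub (R := ℤ) (p := 3) (by exact_mod_cast h2) k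
  rw [one_pow, ← pow_mul] at h3
  rw [show 2 * 3 ^ k * c = 2 * c * 3 ^ k by ring]
  exact_mod_cast h3

/-- `‖N ^ (2·3^k·c) - 1‖ ≤ 3⁻ᵏ` in `ℚ̄₃` for `3 ∤ N`. -/
theorem norm_natCast_pow_sub_one_le {N : ℕ} (hN : ¬ 3 ∣ N) (k c : ℕ) :
    ‖(N : PadicAlgCl 3) ^ (2 * 3 ^ k * c) - 1‖ ≤ ((3 : ℝ)⁻¹) ^ k := by
  have hN' : ¬ (3 : ℤ) ∣ (N : ℤ) := by exact_mod_cast hN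
  obtain ⟨m, hm⟩ := ((pow_dvd_pow (3 : ℤ) (Nat.le_succ k)).trans
    (pow_succ_dvd_pow_sub_one hN' k c))
  have hcast : (N : PadicAlgCl 3) ^ (2 * 3 ^ k * c) - 1 =
      (((N : ℤ) ^ (2 * 3 ^ k * c) - 1 : ℤ) : PadicAlgCl 3) := by push_cast; rfl
  rw [hcast, hm]
  push_cast
  have h3 : ‖(3 : PadicAlgCl 3)‖ = (3 : ℝ)⁻¹ := by exact_mod_cast padicAlgCl_norm_natCast_self 3
  rw [norm_mul, norm_pow, h3]
  exact mul_le_of_le_one_right (by positivity) (norm_intCast_le_one m)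

/-! ### B. The place `𝔐_ι = {z ∈ ℤ̄ : ‖ι⁻¹ z‖ < 1}` is a maximal ideal containing `3` -/

/-- `3 ∈ 𝔐_ι`. -/
theorem three_mem_of_mem_iff (ι : PadicAlgCl 3 ≃+* ℂ) {𝔐 : Ideal (integralClosure ℤ ℂ)}
    (hmem : ∀ r, r ∈ 𝔐 ↔ ‖ι.symm (r : ℂ)‖ < 1) : (3 : integralClosure ℤ ℂ) ∈ 𝔐 := by
  have h3 : ‖(3 : PadicAlgCl 3)‖ = (3 : ℝ)⁻¹ := by exact_mod_cast padicAlgCl_norm_natCast_self 3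
  rw [hmem, show ((3 : integralClosure ℤ ℂ) : ℂ) = 3 from rfl, map_ofNat, h3]
  norm_num

/-- `𝔐_ι` is maximal: it is prime, `ℤ̄ / ℤ` is integral, and `𝔐_ι ∩ ℤ ∋ 3` is a nonzero prime,
hence maximal, ideal of `ℤ`. -/
theorem isMaximal_of_mem_iff (ι : PadicAlgCl 3 ≃+* ℂ) {𝔐 : Ideal (integralClosure ℤ ℂ)}
    (hprime : 𝔐.IsPrime) (hmem : ∀ r, r ∈ 𝔐 ↔ ‖ι.symm (r : ℂ)‖ < 1) : 𝔐.IsMaximal := by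
  haveI := hprime
  refine Ideal.isMaximal_of_isIntegral_of_isMaximal_comap (R := ℤ) 𝔐 ?_
  refine Ideal.IsPrime.isMaximal (Ideal.comap_isPrime _ _) fun hbot => ?_
  have h3 : (3 : ℤ) ∈ 𝔐.comap (algebraMap ℤ (integralClosure ℤ ℂ)) := by
    rw [Ideal.mem_comap, map_ofNat]
    exact three_mem_of_mem_iff ι hmem
  rw [hbot, Ideal.mem_bot] at h3
  exact absurd h3 (by norm_num)

/-! ### C. Bad primes -/

/-- `3 ∤ N𝔭` when `3 ∉ 𝔭` (the residue field has characteristic `≠ 3`). -/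
theorem not_three_dvd_residueCard {K : Type*} [Field K] [NumberField K]
    {𝔭 : HeightOneSpectrum (𝓞 K)} (h3 : (3 : 𝓞 K) ∉ 𝔭.asIdeal) : ¬ 3 ∣ 𝔭.residueCard := by
  classical
  haveI : Finite (𝓞 K ⧸ 𝔭.asIdeal) := 𝔭.asIdeal.finiteQuotientOfFreeOfNeBot 𝔭.ne_bot
  letI : Fintype (𝓞 K ⧸ 𝔭.asIdeal) := Fintype.ofFinite _
  haveI := 𝔭.isMaximal
  letI : Field (𝓞 K ⧸ 𝔭.asIdeal) := Ideal.Quotient.field 𝔭.asIdeal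
  obtain ⟨p, hchar, n, hp, hcard⟩ := FiniteField.card' (𝓞 K ⧸ 𝔭.asIdeal)
  intro hdvd
  rw [HeightOneSpectrum.residueCard_eq_card_quotient, Nat.card_eq_fintype_card, hcard] at hdvd
  have h3p : 3 = p :=
    (Nat.prime_dvd_prime_iff_eq Nat.prime_three hp).1 (Nat.prime_three.dvd_of_dvd_pow hdvd)
  subst h3p
  apply h3
  rw [← Ideal.Quotient.eq_zero_iff_mem, map_ofNat]
  exact_mod_cast CharP.cast_eq_zero (𝓞 K ⧸ 𝔭.asIdeal) 3

/-- For a separable integer quartic, `3 · disc f · lc f ≠ 0`. -/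
theorem three_mul_discr_mul_leadingCoeff_ne_zero {f : ℤ[X]} (hdeg : f.natDegree = 4)
    (hsep : (f.map (Int.castRingHom ℚ)).Separable) :
    (3 * f.discr * f.leadingCoeff : ℤ) ≠ 0 := by
  have hf0 : f ≠ 0 := by rintro rfl; simp at hdeg
  have hlc : f.leadingCoeff ≠ 0 := leadingCoeff_ne_zero.2 hf0
  have hdisc : f.discr ≠ 0 := by
    set φ := Int.castRingHom ℚ
    have hdeg' : (f.map φ).natDegree = 4 := by
      rw [natDegree_map_eq_of_injective φ.injective_int, hdeg]
    have hres := resultant_ne_zero (f.map φ) (derivative (f.map φ))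
      ((Polynomial.separable_def _).1 hsep)
    rw [natDegree_derivative, hdeg', derivative_map, resultant_map_map] at hres
    have h0 : 0 < f.degree := by
      rw [degree_eq_natDegree hf0, hdeg]; norm_num
    have key := resultant_deriv h0
    rw [hdeg] at key
    intro hd
    apply hres
    rw [key, hd, mul_zero, map_zero]
  exact mul_ne_zero (mul_ne_zero (by norm_num) hdisc) hlc

/-! ### D. The dictionary `‖ι⁻¹ t‖ ≤ 3⁻ᵏ ⟹ t ∈ 3ᵏ ℤ̄_𝔐` -/

/-- **Dictionary.**  If `t ∈ ℤ̄` has `‖ι⁻¹ t‖ ≤ 3⁻ᵏ` then `u t ∈ 3ᵏ ℤ̄` for some `u ∉ 𝔐_ι`.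
Proof in the number field `L = ℚ(t)`: with `J = 𝔐_ι ∩ 𝓞 L` (a proper ideal of the Dedekind
domain `𝓞 L`), Mathlib's `Ideal.exist_integer_multiples_notMem` applied to `(1, t/3ᵏ)` gives
`a = w₀ ∈ 𝓞 L` with `w₁ = w₀ t / 3ᵏ ∈ 𝓞 L` and `w₀ ∉ J` or `w₁ ∉ J`; the second case with
`w₀ ∈ J` contradicts `‖w₁‖ 3⁻ᵏ = ‖w₀‖ ‖t‖ ≤ ‖w₀‖ 3⁻ᵏ < 3⁻ᵏ`. -/
theorem exists_not_mem_and_mul_mem_span_pow (ι : PadicAlgCl 3 ≃+* ℂ)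
    {𝔐 : Ideal (integralClosure ℤ ℂ)} (hmem : ∀ r, r ∈ 𝔐 ↔ ‖ι.symm (r : ℂ)‖ < 1)
    (t : integralClosure ℤ ℂ) (k : ℕ) (ht : ‖ι.symm (t : ℂ)‖ ≤ ((3 : ℝ)⁻¹) ^ k) :
    ∃ u : integralClosure ℤ ℂ, u ∉ 𝔐 ∧ u * t ∈ Ideal.span {(3 : integralClosure ℤ ℂ) ^ k} := by
  classical
  -- the number field `L = ℚ(t)` and its ring of integers
  have hti : IsIntegral ℤ (t : ℂ) := t.2
  let L : IntermediateField ℚ ℂ := IntermediateField.adjoin ℚ {(t : ℂ)}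
  haveI : FiniteDimensional ℚ L := IntermediateField.adjoin.finiteDimensional hti.tower_top
  haveI : NumberField L := NumberField.mk
  -- the restriction `𝓞 L → ℤ̄`
  let g : 𝓞 L →+* integralClosure ℤ ℂ :=
    { toFun := fun b => ⟨((b : L) : ℂ),
        map_isIntegral_int (algebraMap L ℂ) (NumberField.RingOfIntegers.isIntegral_coe b)⟩
      map_one' := rfl
      map_mul' := fun _ _ => rfl
      map_zero' := rfl
      map_add' := fun _ _ => rfl }
  have hg : ∀ b : 𝓞 L,
      ((g b : integralClosure ℤ ℂ) : ℂ) = algebraMap L ℂ (algebraMap (𝓞 L) L b) := fun b => rfl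
  -- the prime `J = 𝔐 ∩ 𝓞 L`
  let J : Ideal (𝓞 L) := 𝔐.comap g
  have hJ : ∀ b, b ∈ J ↔ ‖ι.symm (algebraMap L ℂ (algebraMap (𝓞 L) L b))‖ < 1 := fun b => by
    rw [Ideal.mem_comap, hmem, hg]
  have hJtop : J ≠ ⊤ := by
    rw [Ideal.ne_top_iff_one, hJ, map_one, map_one, map_one, norm_one]
    exact lt_irrefl 1
  -- `t` as an element `t'` of `𝓞 L`
  have htL : (t : ℂ) ∈ L := IntermediateField.mem_adjoin_simple_self ℚ (t : ℂ)
  have htI : IsIntegral ℤ (⟨(t : ℂ), htL⟩ : L) :=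
    (isIntegral_algHom_iff (algebraMap L ℂ).toIntAlgHom (algebraMap L ℂ).injective).mp hti
  let t' : 𝓞 L := ⟨⟨(t : ℂ), htL⟩, htI⟩
  have hgt : g t' = t := Subtype.ext rfl
  -- Dedekind: clear denominators of `(1, t / 3ᵏ)` outside `J`
  obtain ⟨a, hint, i, -, hi⟩ := Ideal.exist_integer_multiples_notMem (K := L) hJtop
    Finset.univ ![(1 : L), algebraMap (𝓞 L) L t' / 3 ^ k] (Finset.mem_univ 0) (by simp)
  obtain ⟨w₀, hw₀⟩ := hint 0 (Finset.mem_univ _)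
  obtain ⟨w₁, hw₁⟩ := hint 1 (Finset.mem_univ _)
  simp only [Fin.isValue, Matrix.cons_val_zero, Matrix.cons_val_one, mul_one] at hw₀ hw₁
  -- `w₁ · 3ᵏ = w₀ · t'` in `𝓞 L`
  have hrel : w₁ * 3 ^ k = w₀ * t' := by
    apply NumberField.RingOfIntegers.coe_injective
    simp only [map_mul, map_pow, map_ofNat, hw₀, hw₁]
    field_simp
  -- `w₀ ∉ J`
  have hw₀J : w₀ ∉ J := by
    intro hw₀J
    fin_cases i
    · simp only [Fin.zero_eta, Fin.isValue, Matrix.cons_val_zero, mul_one] at hi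
      exact hi ((FractionalIdeal.mem_coeIdeal _).2 ⟨w₀, hw₀J, hw₀⟩)
    · simp only [Fin.mk_one, Fin.isValue, Matrix.cons_val_one] at hi
      have hw₁J : w₁ ∉ J := fun h1 => hi ((FractionalIdeal.mem_coeIdeal _).2 ⟨w₁, h1, hw₁⟩)
      rw [hJ] at hw₀J hw₁J
      have key :=
        congrArg (fun b : 𝓞 L => ‖ι.symm (algebraMap L ℂ (algebraMap (𝓞 L) L b))‖) hrel
      have h3 : ‖(3 : PadicAlgCl 3)‖ = (3 : ℝ)⁻¹ := by
        exact_mod_cast padicAlgCl_norm_natCast_self 3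
      simp only [map_mul, map_pow, map_ofNat, norm_mul, norm_pow, h3] at key
      -- key : ‖w₁‖ * 3⁻¹ ^ k = ‖w₀‖ * ‖t‖
      have h1 : (1 : ℝ) * ((3 : ℝ)⁻¹) ^ k ≤
          ‖ι.symm (algebraMap L ℂ (algebraMap (𝓞 L) L w₁))‖ * ((3 : ℝ)⁻¹) ^ k :=
        mul_le_mul_of_nonneg_right (not_lt.1 hw₁J) (by positivity)
      have h2 : ‖ι.symm (algebraMap L ℂ (algebraMap (𝓞 L) L w₀))‖ * ‖ι.symm (t : ℂ)‖ <
          1 * ((3 : ℝ)⁻¹) ^ k := by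
        refine lt_of_le_of_lt (mul_le_mul_of_nonneg_left ht (norm_nonneg _)) ?_
        exact mul_lt_mul_of_pos_right hw₀J (by positivity)
      have : algebraMap L ℂ (algebraMap (𝓞 L) L t') = (t : ℂ) := rfl
      rw [this] at key
      linarith
  refine ⟨g w₀, hw₀J, Ideal.mem_span_singleton'.2 ⟨g w₁, ?_⟩⟩
  rw [← hgt, ← map_mul, ← hrel, map_mul, map_pow, map_ofNat]

/-! ### E. The vocabulary-specific steps -/

/-- Values of the Picard point have norm `≤ 1`: `𝒪` is finite over `ℤ₃` and `j` is a
`ℤ₃`-algebra map, so `j (x r)` is integral over `ℤ₃`. -/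
theorem norm_j_x_le_one {f : ℤ[X]} {ι : PadicAlgCl 3 ≃+* ℂ} {e : K →+* ℂ} (d : PointData f ι e)
    (r : d.𝓡.R) : ‖d.j (d.x r)‖ ≤ 1 := by
  haveI : Algebra.IsIntegral ℤ_[3] d.𝒪 := Algebra.IsIntegral.of_finite ℤ_[3] d.𝒪
  refine norm_le_one_of_isIntegral_padicInt ?_
  exact (Algebra.IsIntegral.isIntegral (R := ℤ_[3]) (d.x r)).map_of_comp_eq (RingHom.id ℤ_[3])
    d.j (by rw [RingHom.comp_id, d.j_comp])

/-- `𝔭 ∉ S(f)` forces `3 ∉ 𝔭` (`3 ∣ 3 · disc f · lc f`). -/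
theorem three_not_mem_of_not_mem_badPrimes {f : ℤ[X]} {𝔭 : HeightOneSpectrum (𝓞 K)}
    (h𝔭 : 𝔭 ∉ badPrimes f) : (3 : 𝓞 K) ∉ 𝔭.asIdeal := by
  intro h3
  apply h𝔭
  change ((3 * f.discr * f.leadingCoeff : ℤ) : 𝓞 K) ∈ 𝔭.asIdeal
  rw [mul_assoc, Int.cast_mul, Int.cast_ofNat]
  exact Ideal.mul_mem_right _ _ h3

/-- `S(f)` is finite for generic `f` (`3 · disc f · lc f ≠ 0` has finitely many prime factors). -/
theorem badPrimes_finite {f : ℤ[X]} (hf : Generic f) : (badPrimes f).Finite := by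
  have hc : ((3 * f.discr * f.leadingCoeff : ℤ) : 𝓞 K) ≠ 0 := by
    exact_mod_cast three_mul_discr_mul_leadingCoeff_ne_zero hf.1 hf.2.1
  refine (Ideal.finite_factors (mt Ideal.span_singleton_eq_bot.1 hc)).subset fun v hv => ?_
  exact Ideal.dvd_span_singleton.2 hv

/-! ### F. The stub -/

/-- **STUB 5 (endgame) of the line `free-seed-smooth-rt`.**  With `e := e`, `S := S(f)` (finite for
generic `f`) and `𝔐 := {z ∈ ℤ̄ : ‖ι⁻¹ z‖ < 1}` (maximal, `∋ 3`): for each `k`, a point `y` over an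
arithmetic weight with `‖y - x'‖ ≤ 3⁻ᵏ` is classical (`h.classical`), giving `P_k` with
`ι(y(φ tr ρ(Frob_𝔭))) · N𝔭^{2·3ᵏc} = N𝔭 · Σα =: b ∈ ℤ̄` off `S(f)`; with `t := b - e(a_𝔭)`,
`ι⁻¹ t = (y - x')(φ tr) · N^{…} + x'(φ tr) · (N^{…} - 1)` has norm `≤ 3⁻ᵏ` (ultrametric; values of
`x' = j ∘ x` are integral; `N^{2·3ᵏc} ≡ 1 mod 3ᵏ⁺¹`), and the dictionary
`exists_not_mem_and_mul_mem_span_pow` turns this into `u t ∈ 3ᵏ ℤ̄`, `u ∉ 𝔐`. -/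
theorem stub_endgame : S.stub_endgame := by
  intro f hcpt ι e d h x' hf hx' hacc
  obtain ⟨𝔐, h𝔐, hmem⟩ := exists_ideal_mem_iff_norm_lt_one
    (ι.symm.toRingHom.comp (algebraMap (integralClosure ℤ ℂ) ℂ))
    (fun z => norm_symm_coe_le_one ι z)
  change ∀ r, r ∈ 𝔐 ↔ ‖ι.symm (r : ℂ)‖ < 1 at hmem
  refine ⟨e, 𝔐, (badPrimes_finite hf).toFinset, isMaximal_of_mem_iff ι h𝔐 hmem,
    three_mem_of_mem_iff ι hmem, fun k => ?_⟩
  obtain ⟨κ, hκ, y, hyΛ, hyx⟩ := hacc k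
  obtain ⟨c, P, hPreg, hP⟩ := h.classical y (hyΛ ▸ hκ) k
  refine ⟨P, hPreg, fun 𝔭 h𝔭S => ?_⟩
  have h𝔭 : 𝔭 ∉ badPrimes f := fun h' => h𝔭S ((badPrimes_finite hf).mem_toFinset.2 h')
  obtain ⟨α, b, hα, hb, hfrob⟩ := hP 𝔭 h𝔭
  obtain ⟨𝔓, h𝔓⟩ := 𝔭.primesAbove_nonempty
  obtain ⟨σ, hσ⟩ := HeightOneSpectrum.exists_isArithFrobAt_of_mem_primesAbove_holds (v := 𝔭) h𝔓
  -- the algebraic integer `e(a_𝔭)`; the congruence is about `t = b - e(a_𝔭)`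
  let a : integralClosure ℤ ℂ := ⟨e ((picardTrace f 𝔭 : 𝓞 K) : K),
    map_isIntegral_int e (NumberField.RingOfIntegers.isIntegral_coe (picardTrace f 𝔭))⟩
  -- the `3`-adic estimate `‖ι⁻¹ t‖ ≤ 3⁻ᵏ`
  have hest : ‖ι.symm ((b - a : integralClosure ℤ ℂ) : ℂ)‖ ≤ ((3 : ℝ)⁻¹) ^ k := by
    have h1 := hfrob 𝔓 h𝔓 σ hσ
    have h2 := d.x_trace 𝔭 h𝔭 𝔓 h𝔓 σ hσ
    have h3 : x' (h.φ (d.𝓡.ρ σ).val.trace) = d.j (d.x (d.𝓡.ρ σ).val.trace) := by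
      simpa using RingHom.congr_fun hx' (d.𝓡.ρ σ).val.trace
    have hb' : ι.symm (b : ℂ) =
        y (h.φ (d.𝓡.ρ σ).val.trace) * (𝔭.residueCard : PadicAlgCl 3) ^ (2 * 3 ^ k * c) := by
      rw [← h1, map_mul, map_pow, map_natCast, RingEquiv.symm_apply_apply]
    have ha' : ι.symm (a : ℂ) = x' (h.φ (d.𝓡.ρ σ).val.trace) := by
      rw [h3, h2]; rfl
    have hsub : ((b - a : integralClosure ℤ ℂ) : ℂ) = (b : ℂ) - (a : ℂ) := rfl
    rw [hsub, map_sub, hb', ha']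
    set Y := y (h.φ (d.𝓡.ρ σ).val.trace)
    set X := x' (h.φ (d.𝓡.ρ σ).val.trace)
    set Nq := (𝔭.residueCard : PadicAlgCl 3)
    have hN : ‖Nq‖ ≤ 1 := norm_natCast_le_one _
    have hX : ‖X‖ ≤ 1 := h3 ▸ norm_j_x_le_one d _
    have hYX : ‖Y - X‖ ≤ ((3 : ℝ)⁻¹) ^ k := hyx _
    have hNE : ‖Nq ^ (2 * 3 ^ k * c) - 1‖ ≤ ((3 : ℝ)⁻¹) ^ k :=
      norm_natCast_pow_sub_one_le
        (not_three_dvd_residueCard (three_not_mem_of_not_mem_badPrimes h𝔭)) k c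
    calc ‖Y * Nq ^ (2 * 3 ^ k * c) - X‖
        = ‖(Y - X) * Nq ^ (2 * 3 ^ k * c) + X * (Nq ^ (2 * 3 ^ k * c) - 1)‖ := by ring_nf
      _ ≤ max ‖(Y - X) * Nq ^ (2 * 3 ^ k * c)‖ ‖X * (Nq ^ (2 * 3 ^ k * c) - 1)‖ :=
          IsUltrametricDist.norm_add_le_max _ _
      _ ≤ ((3 : ℝ)⁻¹) ^ k := by
          refine max_le ?_ ?_
          · rw [norm_mul, norm_pow]
            calc ‖Y - X‖ * ‖Nq‖ ^ (2 * 3 ^ k * c) ≤ ((3 : ℝ)⁻¹) ^ k * 1 :=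
                  mul_le_mul hYX (pow_le_one₀ (norm_nonneg _) hN) (by positivity) (by positivity)
              _ = ((3 : ℝ)⁻¹) ^ k := mul_one _
          · rw [norm_mul]
            calc ‖X‖ * ‖Nq ^ (2 * 3 ^ k * c) - 1‖ ≤ 1 * ((3 : ℝ)⁻¹) ^ k :=
                  mul_le_mul hX hNE (norm_nonneg _) zero_le_one
              _ = ((3 : ℝ)⁻¹) ^ k := one_mul _
  obtain ⟨u, hu, hut⟩ := exists_not_mem_and_mul_mem_span_pow ι hmem (b - a) k hest
  refine ⟨α, b - a, u, hα, ?_, hu, hut⟩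
  change (b : ℂ) - (a : ℂ) = _
  rw [hb]

end

end Summit.Langlands.Langlands.Cruxes.MuOrdinaryFamilyRT.FreeSeedSmoothRt
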